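import Literature.Topology.FourManifolds.SurfaceGroupLiftableMoves
import Literature.Topology.FourManifolds.SurfaceGroupReflection
import Literature.Topology.FourManifolds.SurfaceGroupCyclicShift
import Literature.Topology.FourManifolds.StandardTrisectionSlotSymmetry
import Mathlib.Data.List.Rotate
import Mathlib.Tactic.Group
import HarnessLib

/-!
# The cyclic shift, the reflection and the relator-fixing automorphisms of `S_g` lift

Topic `Literature/Topology/FourManifolds`; sequel to `SurfaceGroupLiftableMoves.lean` and
`SurfaceGroupLiftableSlides.lean`, completing the list of the tree's explicit automorphisms of the
surface group `S_g = ⟨a₀, b₀, …, a_{g-1}, b_{g-1} ∣ ∏ᵢ [aᵢ, bᵢ]⟩` that are *liftable* in the sense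
of Nielsen's theorem (`nielsen_surfaceGroup_mulEquiv_lift`; the hypothesis shape of
`TrisectionKernels.iso_stabilize_map_of_lift`: induced by an automorphism `φ` of the free group
`F⟨a₀, …, b_{g-1}⟩` with `φ(r_g) = c · r_g^ε · c⁻¹`, `ε = ±1`):

* `RelatorAut.liftable_toMulEquiv` — the automorphism of `S_g` packaged by a `RelatorAut`
  (`StandardTrisectionSlotSymmetry.lean`: a free automorphism with inverse, both fixing `r_g` on
  the nose) is liftable by its own data (`ε = 1`, `c = 1`);
* `SurfaceGroup.liftable_cycShiftEquiv` — the cyclic handle shift `a_k ↦ a_{k+j}`, `b_k ↦ b_{k+j}`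
  (`SurfaceGroupCyclicShift.lean`) lifts to the relabelling of the free generators, which ROTATES
  the list of commutators: `φ(r_g) = c · r_g · c⁻¹` with `c⁻¹` the product of the first `j mod g`
  commutators (`ε = 1`);
* `SurfaceGroup.liftable_reflEquiv` — the reflection `a_k ↦ b_{-k} a_{-k} b_{-k}⁻¹`,
  `b_k ↦ b_{-k}⁻¹` (`SurfaceGroupReflection.lean`) lifts to the same words in the free group, which
  REVERSE AND INVERT the list of commutators: `φ(r_g) = c · r_g⁻¹ · c⁻¹` with `c = [a₀, b₀]⁻¹`
  (`ε = -1`, an orientation-reversing lift).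

## References

* J. Nielsen, *Untersuchungen zur Topologie der geschlossenen zweiseitigen Flächen*, Acta Math. 50
  (1927) 189–358, §§ 1–2. [Nielsen1927]
* H. Zieschang, E. Vogt, H.-D. Coldewey, *Surfaces and Planar Discontinuous Groups*, LNM 835
  (1980), §3.2, §5.1 and Thm. 5.6.1. [ZieschangVogtColdewey1980]
-/

noncomputable section

namespace Literature.Topology.FourManifolds

variable {g : ℕ}

/-! ## Relator-fixing free automorphisms -/

/-- **The automorphism of `S_g` induced by a `RelatorAut` is liftable** (by its own free
automorphism, `ε = 1`, `c = 1`). [folklore] -/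
theorem RelatorAut.liftable_toMulEquiv (A : RelatorAut g) :
    ∃ (φ : FreeGroup (surfaceGen g) ≃* FreeGroup (surfaceGen g)) (c : FreeGroup (surfaceGen g))
      (ε : ℤ), (ε = 1 ∨ ε = -1) ∧ φ (surfaceRelator g) = c * surfaceRelator g ^ ε * c⁻¹ ∧
      ∀ x, PresentedGroup.mk _ (φ x) = A.toMulEquiv (PresentedGroup.mk _ x) :=
  ⟨MonoidHom.toMulEquiv A.hom A.inv A.inv_comp A.hom_comp, 1, 1, Or.inl rfl,
    by rw [one_mul, zpow_one, inv_one, mul_one]; exact A.hom_rel, fun x => (A.toMulEquiv_mk x).symm⟩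

namespace SurfaceGroup

/-! ## The cyclic handle shift lifts -/

/-- The relator factors of the free relabelling `(k, s) ↦ ((k + j) mod g, s)` are the shifted
standard factors. [folklore] -/
theorem relFactor_of_shiftFin (j k : ℕ) :
    relFactor (fun p : surfaceGen g => FreeGroup.of (shiftFin j p.1, p.2)) k =
      relFactor (FreeGroup.of : surfaceGen g → FreeGroup (surfaceGen g))
        (if k < g then (k + j) % g else g) := by
  by_cases hk : k < g
  · have hg : 0 < g := lt_of_le_of_lt (Nat.zero_le k) hk
    rw [if_pos hk, relFactor, dif_pos hk, relFactor, dif_pos (Nat.mod_lt _ hg)]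
    rfl
  · rw [if_neg hk, relFactor, dif_neg hk, relFactor, dif_neg (lt_irrefl g)]

/-- **The free relabelling `a_k ↦ a_{k+j}`, `b_k ↦ b_{k+j}` rotates the list of commutators**, so it
sends `r_g` to the conjugate `c · r_g · c⁻¹`, `c⁻¹ = ∏_{i < j mod g} [aᵢ, bᵢ]`. [folklore] -/
theorem lift_shiftFin_surfaceRelator (j : ℕ) :
    FreeGroup.lift (fun p : surfaceGen g => FreeGroup.of (shiftFin j p.1, p.2)) (surfaceRelator g) =
      ((((List.range g).map (relFactor (FreeGroup.of : surfaceGen g → FreeGroup (surfaceGen g)))).take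
          (j % g)).prod)⁻¹ * surfaceRelator g *
        ((((List.range g).map (relFactor (FreeGroup.of : surfaceGen g → FreeGroup (surfaceGen g)))).take
          (j % g)).prod)⁻¹⁻¹ := by
  set L := (List.range g).map (relFactor (FreeGroup.of : surfaceGen g → FreeGroup (surfaceGen g)))
    with hL
  have hr : surfaceRelator g = L.prod := by
    rw [hL, ← lift_surfaceRelator, FreeGroup.lift_of_apply]
  have hlen : L.length = g := by rw [hL, List.length_map, List.length_range]
  have h : (List.range g).map (relFactor fun p : surfaceGen g => FreeGroup.of (shiftFin j p.1, p.2)) =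
      L.rotate j := by
    rw [hL, ← List.map_rotate, ← range_map_add_mod, List.map_map]
    refine List.map_congr_left fun k hk => ?_
    rw [List.mem_range] at hk
    rw [Function.comp_apply, relFactor_of_shiftFin, if_pos hk]
  rw [lift_surfaceRelator, h, List.rotate_eq_drop_append_take_mod, hlen, List.prod_append, hr,
    ← List.prod_take_mul_prod_drop L (j % g), inv_inv]
  group

/-- **The cyclic handle shift `cycShiftEquiv g j` is liftable** (`ε = 1`): its free lift is the
relabelling of the generators, sending `r_g` to a conjugate of itself (a rotation of the cyclic
word `∏ [aᵢ, bᵢ]`). [cite: ZieschangVogtColdewey1980, §3.2 and Thm. 5.6.1] -/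
theorem liftable_cycShiftEquiv (g j : ℕ) :
    ∃ (φ : FreeGroup (surfaceGen g) ≃* FreeGroup (surfaceGen g)) (c : FreeGroup (surfaceGen g))
      (ε : ℤ), (ε = 1 ∨ ε = -1) ∧ φ (surfaceRelator g) = c * surfaceRelator g ^ ε * c⁻¹ ∧
      ∀ x, PresentedGroup.mk _ (φ x) = cycShiftEquiv g j (PresentedGroup.mk _ x) := by
  refine liftable_of_gens (cycShiftEquiv g j)
    (fun p => FreeGroup.of (shiftFin j p.1, p.2)) (fun p => FreeGroup.of (shiftFin (g * j - j) p.1, p.2))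
    ((((List.range g).map (relFactor (FreeGroup.of : surfaceGen g → FreeGroup (surfaceGen g)))).take
      (j % g)).prod)⁻¹ 1 (Or.inl rfl) ?_ ?_ ?_ ?_
  · rw [zpow_one]
    exact lift_shiftFin_surfaceRelator j
  · intro p
    rw [FreeGroup.lift_apply_of, shiftFin_shiftFin_inv]
  · intro p
    rw [FreeGroup.lift_apply_of, shiftFin_inv_shiftFin]
  · intro p
    rw [cycShiftEquiv_of, mk_freeGroup_of]

/-! ## The reflection lifts -/

/-- Handle by handle the free reflection words invert the commutator:
`[b a b⁻¹, b⁻¹] = [a, b]⁻¹` in the free group. [folklore] -/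
theorem relFactor_reflWords (k : Fin g) :
    relFactor (fun p : surfaceGen g => cond p.2 (genB (negFin p.1))⁻¹
        (genB (negFin p.1) * genA (negFin p.1) * (genB (negFin p.1))⁻¹)) k =
      (relFactor (FreeGroup.of : surfaceGen g → FreeGroup (surfaceGen g)) (negFin k))⁻¹ := by
  rw [relFactor_fin, relFactor_fin]
  simp only [cond_true, cond_false, mul_inv_rev, inv_inv, genA, genB]
  group

/-- The list of the reflected commutators of the handles `1, …, n` of the free group of `S_{n+1}`
is the reversed list of the inverses of their commutators. [folklore] -/
theorem map_relFactor_reflWords_succ (n : ℕ) :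
    (List.range n).map (fun j => relFactor (fun p : surfaceGen (n + 1) => cond p.2 (genB (negFin p.1))⁻¹
        (genB (negFin p.1) * genA (negFin p.1) * (genB (negFin p.1))⁻¹)) (j + 1)) =
      (((List.range n).map fun j =>
        relFactor (FreeGroup.of : surfaceGen (n + 1) → FreeGroup (surfaceGen (n + 1))) (j + 1)).map
          (fun x => x⁻¹)).reverse := by
  -- adapted from `map_relFactor_reflGens_succ` (`SurfaceGroupReflection.lean`)
  refine List.ext_getElem (by simp) fun i h₁ h₂ => ?_
  rw [List.length_map, List.length_range] at h₁
  simp only [List.getElem_map, List.getElem_range, List.getElem_reverse, List.length_map,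
    List.length_range]
  rw [show (i + 1 : ℕ) = ((⟨i + 1, by omega⟩ : Fin (n + 1)) : ℕ) from rfl, relFactor_reflWords]
  congr 2
  rw [val_negFin]
  dsimp only
  rw [Nat.mod_eq_of_lt (by omega)]
  omega

/-- **The free reflection words send `r_g` to `[a₀,b₀]⁻¹ · r_g⁻¹ · [a₀,b₀]`**: reading
`a_k ↦ b_{-k} a_{-k} b_{-k}⁻¹`, `b_k ↦ b_{-k}⁻¹` in the free group reverses and inverts the list of
commutators. [folklore] -/
theorem lift_reflWords_surfaceRelator (g : ℕ) :
    FreeGroup.lift (fun p : surfaceGen g => cond p.2 (genB (negFin p.1))⁻¹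
        (genB (negFin p.1) * genA (negFin p.1) * (genB (negFin p.1))⁻¹)) (surfaceRelator g) =
      (relFactor (FreeGroup.of : surfaceGen g → FreeGroup (surfaceGen g)) 0)⁻¹ * (surfaceRelator g)⁻¹ *
        (relFactor (FreeGroup.of : surfaceGen g → FreeGroup (surfaceGen g)) 0)⁻¹⁻¹ := by
  cases g with
  | zero => simp [surfaceRelator, relFactor]
  | succ n =>
    have hstd : surfaceRelator (n + 1) = ((List.range (n + 1)).map
        (relFactor (FreeGroup.of : surfaceGen (n + 1) → FreeGroup (surfaceGen (n + 1))))).prod := by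
      rw [← lift_surfaceRelator, FreeGroup.lift_of_apply]
    rw [lift_surfaceRelator, hstd]
    rw [List.range_succ_eq_map, List.map_cons, List.map_map, List.prod_cons, List.map_cons,
      List.map_map, List.prod_cons]
    have h0 : relFactor (fun p : surfaceGen (n + 1) => cond p.2 (genB (negFin p.1))⁻¹
        (genB (negFin p.1) * genA (negFin p.1) * (genB (negFin p.1))⁻¹)) 0 =
        (relFactor (FreeGroup.of : surfaceGen (n + 1) → FreeGroup (surfaceGen (n + 1))) 0)⁻¹ := by
      rw [show (0 : ℕ) = ((0 : Fin (n + 1)) : ℕ) from rfl, relFactor_reflWords]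
      congr 2
      simp
    have hcomp : (relFactor (fun p : surfaceGen (n + 1) => cond p.2 (genB (negFin p.1))⁻¹
        (genB (negFin p.1) * genA (negFin p.1) * (genB (negFin p.1))⁻¹)) ∘ Nat.succ) =
        fun j => relFactor (fun p : surfaceGen (n + 1) => cond p.2 (genB (negFin p.1))⁻¹
          (genB (negFin p.1) * genA (negFin p.1) * (genB (negFin p.1))⁻¹)) (j + 1) := rfl
    have hcomp' : (relFactor (FreeGroup.of : surfaceGen (n + 1) → FreeGroup (surfaceGen (n + 1))) ∘
        Nat.succ) = fun j =>
          relFactor (FreeGroup.of : surfaceGen (n + 1) → FreeGroup (surfaceGen (n + 1))) (j + 1) := rfl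
    rw [hcomp, map_relFactor_reflWords_succ, h0, ← List.prod_inv_reverse, hcomp']
    group

/-- **The reflection `reflEquiv g` is liftable** (`ε = -1`, `c = [a₀, b₀]⁻¹`): the words
`a_k ↦ b_{-k} a_{-k} b_{-k}⁻¹`, `b_k ↦ b_{-k}⁻¹` define an involution of the free group sending
`r_g` to a conjugate of `r_g⁻¹` — an orientation-reversing Nielsen lift.
[cite: ZieschangVogtColdewey1980, §3.2 and Thm. 5.6.1] -/
theorem liftable_reflEquiv (g : ℕ) :
    ∃ (φ : FreeGroup (surfaceGen g) ≃* FreeGroup (surfaceGen g)) (c : FreeGroup (surfaceGen g))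
      (ε : ℤ), (ε = 1 ∨ ε = -1) ∧ φ (surfaceRelator g) = c * surfaceRelator g ^ ε * c⁻¹ ∧
      ∀ x, PresentedGroup.mk _ (φ x) = reflEquiv g (PresentedGroup.mk _ x) := by
  refine liftable_of_gens (reflEquiv g)
    (fun p => cond p.2 (genB (negFin p.1))⁻¹ (genB (negFin p.1) * genA (negFin p.1) * (genB (negFin p.1))⁻¹))
    (fun p => cond p.2 (genB (negFin p.1))⁻¹ (genB (negFin p.1) * genA (negFin p.1) * (genB (negFin p.1))⁻¹))
    (relFactor (FreeGroup.of : surfaceGen g → FreeGroup (surfaceGen g)) 0)⁻¹ (-1) (Or.inr rfl) ?_ ?_ ?_ ?_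
  · rw [zpow_neg_one]
    exact lift_reflWords_surfaceRelator g
  · rintro ⟨k, _ | _⟩
    · simp only [cond_false, cond_true, map_mul, map_inv, genA, genB, FreeGroup.lift_apply_of,
        negFin_negFin]
      group
    · simp only [cond_true, map_inv, genB, FreeGroup.lift_apply_of, negFin_negFin, inv_inv]
  · rintro ⟨k, _ | _⟩
    · simp only [cond_false, cond_true, map_mul, map_inv, genA, genB, FreeGroup.lift_apply_of,
        negFin_negFin]
      group
    · simp only [cond_true, map_inv, genB, FreeGroup.lift_apply_of, negFin_negFin, inv_inv]
  · rintro ⟨k, _ | _⟩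
    · rw [reflEquiv_of, reflGens_false]
      simp only [cond_false, map_mul, map_inv, mk_genA, mk_genB]
    · rw [reflEquiv_of, reflGens_true]
      simp only [cond_true, map_inv, mk_genB]

end SurfaceGroup

end Literature.Topology.FourManifolds

end
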